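import Mathlib
import HarnessLib
import Summits.HubbardSuperconductivity.HubbardSuperconductivity.Theorems.KLProgrammeCutCurrencyLegMass
import Summits.HubbardSuperconductivity.HubbardSuperconductivity.Theorems.KLProgrammeKLRegimeSplitDefs

/-!
# Route `KLProgramme` — ENGINE (stmt-HubbardSuperconductivity-20437 `KLRegimeEngineV17F2`), located #25 «(b)-PLAIN-UV-TAIL», cure (α),
# E1 item (i), THE NUMBER: `A(ĝ∘ω) ≤ 15` AND `ε³Σ‖W₄(S_ĝV)‖ ≤ (|U|/24)·15⁴` UNIFORMLY IN `klBetaMin ≤ β ≤ M`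
# (cell gate-hubbard-kl, seat hubbard-kl-k3c2-p2 g35)

The β- and `M`-explicit leg-mass bound of `…CutCurrencyLegMass` (`klct_legMass_uvCut_le`, free parameter `J`) made uniform:
* `klct_legMass_uvCut_le_support` — the support bound `A ≤ β/(8π) + 1` (`0 < β`; no summation by parts);
* **`klct_legMass_uvCut_le_fifteen`** — `A(ĝ∘ω) ≤ 15` for `128 ≤ β ≤ M`: `β ≤ 340` by the support bound, `β ≥ 340` by `J = ⌈150M/β⌉`
  (`150S/β + 3S/(2β) ≤ 13/2`, `C₂β/600 = Kπ/800 + 2Kπ²/(25β) ≤ 8`);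
* **`klbv_plainCurrency_uvCut_hubbardInteraction_le_numeric`** — the plain pinned `L¹` currency of the UV-cut bare vertex obeys
  `ε_x³ Σ_{x′ : x′_q = y}‖W₄(S_ĝ V)(x′)‖ ≤ (|U|/24)·15⁴` for every `klBetaMin = 128 ≤ β ≤ M`, every `L`, pinned leg `q` and pin `y` —
  the FIRST β- AND `M`-UNIFORM DATUM for the cut plain quartic rows of binders #2/#5/#6 (located #25 cure (α), E1 item (i); [float] truth `≈ 0.113·|U|`,
  HOME/hubbard-kl-k3c2-p2/g34/CUT-CURRENCY-DIGITS.md — the constant here is not optimised: one summation-by-parts order and the crude window count cost ≈ 10×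
  in `A`).
No definition; nothing asserts any row, (b), (C), K3, U₀, the window or superconductivity.
References: BGM 2006 §2.2–2.3 [cite: BenfattoGiulianiMastropietro2006].
-/

noncomputable section

namespace Summit.HubbardSuperconductivity.HubbardSuperconductivity.Theorems.KLRegimeSplit

set_option linter.dupNamespace false -- summit = problem name (single-conjunct summit), D-0017

open Finset Literature.MathematicalPhysics.QuantumLattice Literature.Probability.LatticeModels GrassmannAlgebra

variable {L M : ℕ} [NeZero M]

/-! ## §1 The support bound (small `β`) -/

/-- **Support bound**: `A(ĝ∘ω) ≤ β/(8π) + 1` (`0 < β`) — every leg transform is bounded by the total sample mass. -/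
theorem klct_legMass_uvCut_le_support {β : ℝ} (hβ : 0 < β) :
    (((2 * M : ℕ) : ℝ))⁻¹ * ∑ j : ImagTimeIdx M, ‖∑ n : MatsubaraIdx M, (((gnScaleCutoff 4 klE0 1 |matsubaraFreq β M n| : ℝ) : ℂ)) *
        Complex.exp (-((2 * Real.pi * ((n : ℕ) : ℝ) * ((j : ℕ) : ℝ) / (2 * M) : ℝ) : ℂ) * Complex.I)‖ ≤ β / (8 * Real.pi) + 1 := by
  have hMne := NeZero.ne M
  have hNr : (0 : ℝ) < ((2 * M : ℕ) : ℝ) := by exact_mod_cast (by omega : 0 < 2 * M)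
  have hle : ∀ j : ImagTimeIdx M, ‖∑ n : MatsubaraIdx M, (((gnScaleCutoff 4 klE0 1 |matsubaraFreq β M n| : ℝ) : ℂ)) *
      Complex.exp (-((2 * Real.pi * ((n : ℕ) : ℝ) * ((j : ℕ) : ℝ) / (2 * M) : ℝ) : ℂ) * Complex.I)‖ ≤ β / (8 * Real.pi) + 1 := by
    intro j
    refine (norm_sum_le _ _).trans ?_
    have : ∀ n : MatsubaraIdx M, ‖(((gnScaleCutoff 4 klE0 1 |matsubaraFreq β M n| : ℝ) : ℂ)) *
        Complex.exp (-((2 * Real.pi * ((n : ℕ) : ℝ) * ((j : ℕ) : ℝ) / (2 * M) : ℝ) : ℂ) * Complex.I)‖ = gnScaleCutoff 4 klE0 1 |matsubaraFreq β M n| := by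
      intro n
      rw [norm_mul, klct_norm_cexp_neg_real_mul_I, mul_one, Complex.norm_real, Real.norm_eq_abs, abs_of_nonneg (klct_uvCutoff_mem_Icc _).1]
    simp_rw [this]
    exact klct_sum_uvCutoff_le hβ
  rw [inv_mul_le_iff₀ hNr]
  calc _ ≤ ∑ _j : ImagTimeIdx M, (β / (8 * Real.pi) + 1) := Finset.sum_le_sum (fun j _ => hle j)
    _ = _ := by rw [Finset.sum_const, Finset.card_univ, Fintype.card_fin, nsmul_eq_mul]

/-! ## §2 The number `15` -/

/-- Arithmetic of the large-`β` branch: for `340 ≤ β`, `(β/(8π)+1)(150/β + 3/(2β)) ≤ 13/2`. -/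
theorem klct_numeric_piece_support {β : ℝ} (hβ : 340 ≤ β) :
    150 * (β / (8 * Real.pi) + 1) / β + 3 * (β / (8 * Real.pi) + 1) / (2 * β) ≤ 13 / 2 := by
  have hβ0 : 0 < β := by linarith
  have hpi := Real.pi_gt_d4
  have hpi0 := Real.pi_pos
  have h1 : 150 * (β / (8 * Real.pi) + 1) / β + 3 * (β / (8 * Real.pi) + 1) / (2 * β) = 303 / (16 * Real.pi) + 303 / (2 * β) := by
    field_simp; ring
  rw [h1]
  have h2 : 303 / (16 * Real.pi) ≤ 6.03 := by rw [div_le_iff₀ (by positivity)]; nlinarith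
  have h3 : 303 / (2 * β) ≤ 303 / (2 * 340) := by gcongr
  norm_num at h3 ⊢
  linarith

/-- Arithmetic of the large-`β` branch: for `340 ≤ β`, `C₂(β)·β/600 = Kπ/800 + 2Kπ²/(25β) ≤ 8`. -/
theorem klct_numeric_piece_decay {β : ℝ} (hβ : 340 ≤ β) :
    (2 * (11264 / 9) * (2 * Real.pi / β) ^ 2 * (3 * β / (32 * Real.pi) + 6)) * β / 600 ≤ 8 := by
  have hβ0 : 0 < β := by linarith
  have hpi := Real.pi_lt_d4
  have hpi0 := Real.pi_pos
  have h1 : (2 * (11264 / 9) * (2 * Real.pi / β) ^ 2 * (3 * β / (32 * Real.pi) + 6)) * β / 600 =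
      (11264 / 9) * Real.pi / 800 + 2 * (11264 / 9) * Real.pi ^ 2 / (25 * β) := by
    field_simp; ring
  rw [h1]
  have h2 : (11264 / 9 : ℝ) * Real.pi / 800 ≤ 4.92 := by nlinarith
  have h3 : 2 * (11264 / 9 : ℝ) * Real.pi ^ 2 / (25 * β) ≤ 2 * (11264 / 9 : ℝ) * 3.1416 ^ 2 / (25 * 340) := by
    gcongr
  norm_num at h3 ⊢
  linarith

/-- **`A(ĝ∘ω) ≤ 15` UNIFORMLY IN `128 ≤ β ≤ M`** (`β ≤ 340`: support bound; `β ≥ 340`: `klct_legMass_uvCut_le` at `J = ⌈150M/β⌉`). -/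
theorem klct_legMass_uvCut_le_fifteen {β : ℝ} (hβ : 128 ≤ β) (hM : β ≤ M) :
    (((2 * M : ℕ) : ℝ))⁻¹ * ∑ j : ImagTimeIdx M, ‖∑ n : MatsubaraIdx M, (((gnScaleCutoff 4 klE0 1 |matsubaraFreq β M n| : ℝ) : ℂ)) *
        Complex.exp (-((2 * Real.pi * ((n : ℕ) : ℝ) * ((j : ℕ) : ℝ) / (2 * M) : ℝ) : ℂ) * Complex.I)‖ ≤ 15 := by
  have hβ0 : 0 < β := by linarith
  have hpi0 := Real.pi_pos
  by_cases hb : β ≤ 340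
  · refine (klct_legMass_uvCut_le_support hβ0).trans ?_
    have hpi := Real.pi_gt_d4
    have : β / (8 * Real.pi) ≤ 340 / (8 * 3.1415) := by
      rw [div_le_div_iff₀ (by positivity) (by norm_num)]; nlinarith
    norm_num at this ⊢
    linarith
  push Not at hb
  have hMr : (340 : ℝ) ≤ M := by linarith
  have hM0 : (0 : ℝ) < M := by linarith
  -- the scale `J = ⌈150 M/β⌉`
  set J : ℕ := ⌈(150 * (M : ℝ) / β)⌉₊ with hJdef
  have harg : 0 < 150 * (M : ℝ) / β := by positivity
  have hJ1 : 1 ≤ J := Nat.succ_le_of_lt (Nat.ceil_pos.mpr harg)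
  have hJlo : 150 * (M : ℝ) / β ≤ (J : ℝ) := Nat.le_ceil _
  have hJhi : (J : ℝ) < 150 * (M : ℝ) / β + 1 := Nat.ceil_lt_add_one harg.le
  have hJpos : (0 : ℝ) < J := by exact_mod_cast hJ1
  refine (klct_legMass_uvCut_le hβ hM hJ1).trans ?_
  set S : ℝ := β / (8 * Real.pi) + 1 with hS
  set C₂ : ℝ := 2 * (11264 / 9) * (2 * Real.pi / β) ^ 2 * (3 * β / (32 * Real.pi) + 6) with hC₂
  have hS0 : 0 ≤ S := by positivity
  have hC₂0 : 0 ≤ C₂ := by positivity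
  have hN : ((2 * M : ℕ) : ℝ) = 2 * (M : ℝ) := by push_cast; ring
  rw [hN]
  -- term 1: `S(2J+1)/(2M) ≤ 150 S/β + 3S/(2M) ≤ 150 S/β + 3S/(2β)`
  have h1 : S * (2 * J + 1) / (2 * (M : ℝ)) ≤ 150 * S / β + 3 * S / (2 * β) := by
    have step1 : S * (2 * J + 1) / (2 * (M : ℝ)) ≤ S * (2 * (150 * (M : ℝ) / β + 1) + 1) / (2 * (M : ℝ)) := by
      gcongr
    refine step1.trans ?_
    have step2 : S * (2 * (150 * (M : ℝ) / β + 1) + 1) / (2 * (M : ℝ)) = 150 * S / β + 3 * S / (2 * M) := by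
      field_simp; ring
    rw [step2]
    gcongr
  -- term 2: `C₂ (2M)/(8J) ≤ C₂ β/600`
  have h2 : C₂ * (2 * (M : ℝ)) / (8 * J) ≤ C₂ * β / 600 := by
    rw [div_le_iff₀ (by positivity)]
    have : C₂ * (2 * (M : ℝ)) = C₂ * β / 600 * (8 * (150 * (M : ℝ) / β)) := by field_simp; ring
    rw [this]
    gcongr
  have hp1 := klct_numeric_piece_support hb.le
  have hp2 := klct_numeric_piece_decay hb.le
  rw [← hS] at hp1
  rw [← hC₂] at hp2
  linarith

/-! ## §3 THE CUT PLAIN CURRENCY, UNIFORMLY -/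

/-- **E1 ITEM (i) OF LOCATED #25, WITH A NUMBER: THE PLAIN PINNED CURRENCY OF THE UV-CUT BARE VERTEX IS AT MOST `(|U|/24)·15⁴` UNIFORMLY**
in `klBetaMin = 128 ≤ β ≤ M` (every torus size `L`, pinned leg `q`, pin `y`):
`ε_x³ Σ_{x′ : x′_q = y}‖W₄(S_ĝ V)(x′)‖ ≤ (|U|/24)·15⁴`.  (✓ p773994's identity, `Θ^cut ≤ A⁴`, `A ≤ 15`.) -/
theorem klbv_plainCurrency_uvCut_hubbardInteraction_le_numeric [NeZero L] {β : ℝ} (hβ : 128 ≤ β) (hM : β ≤ M) (U : ℝ) (q : Fin 4) (y : SpaceTimeIdx L M) :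
    imagTimeWeight β M ^ 3 *
        ∑ x ∈ univ.filter (fun x : Fin 4 → SpaceTimeIdx L M => x q = y),
          ‖sectorisedKernel L M β (trivialMultiplier L M)
            (ExteriorAlgebra.map (LinearMap.mulLeft ℂ (fun K : HubbardFieldIdx L M => ((gnScaleCutoff 4 klE0 1 |matsubaraFreq β M K.1.1.1| : ℝ) : ℂ))) (hubbardInteraction L M β U)) 4
            (![(((0 : Fin 1), (0 : Fin 2)), (0 : Fin 2)), ((0, 0), 1), ((0, 1), 0), ((0, 1), 1)] : Fin 4 → SectorLeg 1) x‖ ≤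
      |U| / 24 * 15 ^ 4 := by
  refine (klbv_plainCurrency_uvCut_hubbardInteraction_le_legMass_pow_four (by linarith) hM U q y).trans ?_
  have hA0 : 0 ≤ (((2 * M : ℕ) : ℝ))⁻¹ * ∑ j : ImagTimeIdx M, ‖∑ n : MatsubaraIdx M, (((gnScaleCutoff 4 klE0 1 |matsubaraFreq β M n| : ℝ) : ℂ)) *
      Complex.exp (-((2 * Real.pi * ((n : ℕ) : ℝ) * ((j : ℕ) : ℝ) / (2 * M) : ℝ) : ℂ) * Complex.I)‖ :=
    mul_nonneg (inv_nonneg.mpr (by positivity)) (Finset.sum_nonneg (fun _ _ => norm_nonneg _))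
  gcongr
  exact klct_legMass_uvCut_le_fifteen hβ hM

/-- The same at the regime's named thermal floor `klBetaMin`. -/
theorem klbv_plainCurrency_uvCut_hubbardInteraction_le_numeric' [NeZero L] {β : ℝ} (hβ : klBetaMin ≤ β) (hM : β ≤ M) (U : ℝ) (q : Fin 4) (y : SpaceTimeIdx L M) :
    imagTimeWeight β M ^ 3 *
        ∑ x ∈ univ.filter (fun x : Fin 4 → SpaceTimeIdx L M => x q = y),
          ‖sectorisedKernel L M β (trivialMultiplier L M)
            (ExteriorAlgebra.map (LinearMap.mulLeft ℂ (fun K : HubbardFieldIdx L M => ((gnScaleCutoff 4 klE0 1 |matsubaraFreq β M K.1.1.1| : ℝ) : ℂ))) (hubbardInteraction L M β U)) 4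
            (![(((0 : Fin 1), (0 : Fin 2)), (0 : Fin 2)), ((0, 0), 1), ((0, 1), 0), ((0, 1), 1)] : Fin 4 → SectorLeg 1) x‖ ≤
      |U| / 24 * 15 ^ 4 :=
  klbv_plainCurrency_uvCut_hubbardInteraction_le_numeric (by rw [klBetaMin] at hβ; exact hβ) hM U q y

end Summit.HubbardSuperconductivity.HubbardSuperconductivity.Theorems.KLRegimeSplit

end
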